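import Literature.Probability.RandomPlanarGeometry.SAWPolygonsFromBridges
import HarnessLib

/-!
# Half-plane self-avoiding pieces `0 → ±e_i` from walks closing next to the origin (`ℤ²`)

Topic `Literature/Probability/RandomPlanarGeometry` (continues `SAWPolygonsFromBridges.lean`: `Zd.eDown`, walks closing next to
the origin; `SAWCount.lean`: `Zd.sawFun`, `Zd.countAt`).

Source: N. Madras, G. Slade, *The Self-Avoiding Walk* (1993), §3.2: eq. (3.2.1) (an `N`-step self-avoiding polygon through a
fixed bond is an `(N−1)`-step self-avoiding walk closing next to the origin, and conversely), eqs. (3.2.3)–(3.2.4) (re-rooting a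
polygon at its lexicographically extreme vertex: "the class `Q_i[N]` of polygons whose lexicographically smallest bond is parallel
to `e_i`"), and the proof of Corollary 3.2.6 (the re-rooted polygon, opened at the extreme vertex, lies in a half-space).  Here,
in the vertex-function vocabulary of the tree: an `m`-step self-avoiding walk `ω : 0 → e↓` together with the bond `{e↓, 0}` is
a closed self-avoiding loop; re-rooting it at the vertex `a` that is extreme in the direction `−s e_k` (ties broken in the
direction `−t e_{k+1}`) and opening it at `a` produces an `m`-step self-avoiding walk `a → a + t e_{k+1}` all of whose vertices
satisfy `s · (y − a)_k ≥ 0`.  Counting the `m + 1` roots and the two orientations: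

* **`countAt_eDown_le_card_halfPlane`**: for `m ≥ 2` and signs `s, t`,
  `c_m(0, e↓) ≤ 2 (m+1) · #{η ∈ sawFun 2 m (t e_{k+1}) : ∀ i ≤ m, 0 ≤ s η(i)_k}`.

These half-plane pieces are the objects inserted into long walks in `SAWEndpointPieceInsertion.lean`.
-/

noncomputable section

open Finset Literature.Probability.LatticeModels SimpleGraph

namespace Literature.Probability.RandomPlanarGeometry.SAW.Zd

namespace HalfPlanePieces

/-! ### Re-rooting a closed loop: index arithmetic without `%` -/

/-- Forward cyclic index `i₀ + l (mod m+1)` for `i₀, l ≤ m`. [folklore] -/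
def idxF (m i₀ l : ℕ) : ℕ := if i₀ + l ≤ m then i₀ + l else i₀ + l - (m + 1)

/-- Backward cyclic index `i₀ − l (mod m+1)` for `i₀, l ≤ m`. [folklore] -/
def idxB (m i₀ l : ℕ) : ℕ := if l ≤ i₀ then i₀ - l else i₀ + (m + 1) - l

/-- The loop `ω(0), …, ω(m), ω(0)` re-rooted at `ω(i₀)`, read forward, translated to start at `0`.
[cite: MadrasSlade1993, §3.2, eqs. (3.2.1), (3.2.3)–(3.2.4) (re-rooting a polygon)] -/
def rerootF (m i₀ : ℕ) (ω : ℕ → Site 2) : ℕ → Site 2 := fun l => ω (idxF m i₀ (min l m)) - ω i₀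

/-- The loop re-rooted at `ω(i₀)`, read backward, translated to start at `0`.
[cite: MadrasSlade1993, §3.2, eqs. (3.2.1), (3.2.3)–(3.2.4) (re-rooting a polygon)] -/
def rerootB (m i₀ : ℕ) (ω : ℕ → Site 2) : ℕ → Site 2 := fun l => ω (idxB m i₀ (min l m)) - ω i₀

/-- Inverse of the forward re-rooting (given the root index). [folklore] -/
def unrootF (m i₀ : ℕ) (π : ℕ → Site 2) : ℕ → Site 2 := fun r =>
  π (if i₀ ≤ min r m then min r m - i₀ else min r m + (m + 1) - i₀) - π (if i₀ = 0 then 0 else m + 1 - i₀)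

/-- Inverse of the backward re-rooting (given the root index). [folklore] -/
def unrootB (m i₀ : ℕ) (π : ℕ → Site 2) : ℕ → Site 2 := fun r =>
  π (if min r m ≤ i₀ then i₀ - min r m else i₀ + (m + 1) - min r m) - π i₀

variable {m i₀ : ℕ} {ω : ℕ → Site 2}

/-- `unrootF` inverts `rerootF` on walks `0 → e↓` frozen after time `m`. [folklore] -/
private theorem unrootF_rerootF (hω : ω ∈ sawFun 2 m eDown) (hi₀ : i₀ ≤ m) : unrootF m i₀ (rerootF m i₀ ω) = ω := by
  obtain ⟨h0, hend, -, -⟩ := mem_sawFun.1 hω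
  funext r
  have hr : ω r = ω (min r m) := by
    rcases le_or_gt r m with h | h
    · rw [min_eq_left h]
    · rw [min_eq_right h.le, hend r h.le, hend m le_rfl]
  rw [hr]
  set r' := min r m with hr'
  have hr'm : r' ≤ m := min_le_right _ _
  simp only [unrootF, rerootF]
  have e0 : idxF m i₀ (min (if i₀ = 0 then 0 else m + 1 - i₀) m) = 0 := by
    unfold idxF; split_ifs <;> omega
  have e1 : idxF m i₀ (min (if i₀ ≤ r' then r' - i₀ else r' + (m + 1) - i₀) m) = r' := by
    unfold idxF; split_ifs <;> omega
  rw [e0, e1, h0]; abel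

/-- `unrootB` inverts `rerootB` on walks `0 → e↓` frozen after time `m`. [folklore] -/
private theorem unrootB_rerootB (hω : ω ∈ sawFun 2 m eDown) (hi₀ : i₀ ≤ m) : unrootB m i₀ (rerootB m i₀ ω) = ω := by
  obtain ⟨h0, hend, -, -⟩ := mem_sawFun.1 hω
  funext r
  have hr : ω r = ω (min r m) := by
    rcases le_or_gt r m with h | h
    · rw [min_eq_left h]
    · rw [min_eq_right h.le, hend r h.le, hend m le_rfl]
  rw [hr]
  set r' := min r m with hr'
  have hr'm : r' ≤ m := min_le_right _ _
  simp only [unrootB, rerootB]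
  have e0 : idxB m i₀ (min i₀ m) = 0 := by
    unfold idxB; rw [min_eq_left hi₀]; simp
  have e1 : idxB m i₀ (min (if r' ≤ i₀ then i₀ - r' else i₀ + (m + 1) - r') m) = r' := by
    unfold idxB; split_ifs <;> omega
  rw [e0, e1, h0]; abel

/-! ### The re-rooted loop is a self-avoiding walk -/

/-- Cyclic adjacency of the closed loop `ω ∪ {e↓, 0}`. [cite: MadrasSlade1993, §3.2, eq. (3.2.1)] -/
private theorem adj_idxF (hω : ω ∈ sawFun 2 m eDown) (hi₀ : i₀ ≤ m) {l : ℕ} (hl : l < m) :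
    (zdGraph 2).Adj (ω (idxF m i₀ l)) (ω (idxF m i₀ (l + 1))) := by
  obtain ⟨h0, hend, hadj, -⟩ := mem_sawFun.1 hω
  unfold idxF
  rcases Nat.lt_trichotomy (i₀ + l) m with h | h | h
  · rw [if_pos h.le, if_pos (by omega), ← add_assoc]; exact hadj _ h
  · rw [if_pos h.le, if_neg (by omega), h, show i₀ + (l + 1) - (m + 1) = 0 by omega, hend m le_rfl, h0]
    exact adj_zero_eDown.symm
  · rw [if_neg (by omega), if_neg (by omega), show i₀ + (l + 1) - (m + 1) = i₀ + l - (m + 1) + 1 by omega]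
    exact hadj _ (by omega)

/-- Cyclic adjacency of the closed loop, backwards. [cite: MadrasSlade1993, §3.2, eq. (3.2.1)] -/
private theorem adj_idxB (hω : ω ∈ sawFun 2 m eDown) (hi₀ : i₀ ≤ m) {l : ℕ} (hl : l < m) :
    (zdGraph 2).Adj (ω (idxB m i₀ l)) (ω (idxB m i₀ (l + 1))) := by
  obtain ⟨h0, hend, hadj, -⟩ := mem_sawFun.1 hω
  unfold idxB
  rcases Nat.lt_trichotomy l i₀ with h | h | h
  · rw [if_pos h.le, if_pos (by omega)]
    have := hadj (i₀ - (l + 1)) (by omega)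
    rw [show i₀ - (l + 1) + 1 = i₀ - l by omega] at this
    exact this.symm
  · rw [if_pos h.le, if_neg (by omega), h, Nat.sub_self, h0, show i₀ + (m + 1) - (i₀ + 1) = m by omega, hend m le_rfl]
    exact adj_zero_eDown
  · rw [if_neg (by omega), if_neg (by omega)]
    have := hadj (i₀ + (m + 1) - (l + 1)) (by omega)
    rw [show i₀ + (m + 1) - (l + 1) + 1 = i₀ + (m + 1) - l by omega] at this
    exact this.symm

/-- The forward re-rooted loop is an `m`-step self-avoiding walk from `0` to `ω(i₀ − 1) − ω(i₀)` (cyclically).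
[cite: MadrasSlade1993, §3.2, eqs. (3.2.1), (3.2.3)–(3.2.4)] -/
private theorem rerootF_mem_sawFun (hω : ω ∈ sawFun 2 m eDown) (hi₀ : i₀ ≤ m) :
    rerootF m i₀ ω ∈ sawFun 2 m (ω (idxF m i₀ m) - ω i₀) := by
  obtain ⟨h0, hend, hadj, hinj⟩ := mem_sawFun.1 hω
  refine mem_sawFun.2 ⟨?_, fun l hl => ?_, fun l hl => ?_, fun a ha b hb hab => ?_⟩
  · simp [rerootF, idxF, hi₀]
  · simp [rerootF, min_eq_right hl]
  · simp only [rerootF, min_eq_left hl.le, min_eq_left (Nat.succ_le_of_lt hl)]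
    rw [zdGraph_adj_sub_right]
    exact adj_idxF hω hi₀ hl
  · simp only [Set.mem_setOf_eq] at ha hb
    simp only [rerootF, min_eq_left ha, min_eq_left hb, sub_left_inj] at hab
    have h1 : idxF m i₀ a ≤ m := by unfold idxF; split_ifs <;> omega
    have h2 : idxF m i₀ b ≤ m := by unfold idxF; split_ifs <;> omega
    have := hinj h1 h2 hab
    unfold idxF at this; split_ifs at this <;> omega

/-- The backward re-rooted loop is an `m`-step self-avoiding walk from `0` to `ω(i₀ + 1) − ω(i₀)` (cyclically).
[cite: MadrasSlade1993, §3.2, eqs. (3.2.1), (3.2.3)–(3.2.4)] -/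
private theorem rerootB_mem_sawFun (hω : ω ∈ sawFun 2 m eDown) (hi₀ : i₀ ≤ m) :
    rerootB m i₀ ω ∈ sawFun 2 m (ω (idxB m i₀ m) - ω i₀) := by
  obtain ⟨h0, hend, hadj, hinj⟩ := mem_sawFun.1 hω
  refine mem_sawFun.2 ⟨?_, fun l hl => ?_, fun l hl => ?_, fun a ha b hb hab => ?_⟩
  · simp [rerootB, idxB]
  · simp [rerootB, min_eq_right hl]
  · simp only [rerootB, min_eq_left hl.le, min_eq_left (Nat.succ_le_of_lt hl)]
    rw [zdGraph_adj_sub_right]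
    exact adj_idxB hω hi₀ hl
  · simp only [Set.mem_setOf_eq] at ha hb
    simp only [rerootB, min_eq_left ha, min_eq_left hb, sub_left_inj] at hab
    have h1 : idxB m i₀ a ≤ m := by unfold idxB; split_ifs <;> omega
    have h2 : idxB m i₀ b ≤ m := by unfold idxB; split_ifs <;> omega
    have := hinj h1 h2 hab
    unfold idxB at this; split_ifs at this <;> omega

/-! ### The extreme root: a half-plane piece ending at `t e_{k+1}` -/

/-- In `Fin 2`, the index different from `k` is `k + 1`. [folklore] -/
private theorem fin_two_eq_add_one {i k : Fin 2} (h : i ≠ k) : i = k + 1 := by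
  revert i k; decide

open Classical in
/-- **The extreme root.** For signs `s, t` and `m ≥ 2`, every `m`-step self-avoiding walk `ω : 0 → e↓` has a root
`i₀ ≤ m` such that one of the two re-rooted readings of the loop `ω ∪ {e↓, 0}` is an `m`-step self-avoiding walk
`0 → t e_{k+1}` in the half-plane `{s y_k ≥ 0}` (root = the vertex extreme in direction `−s e_k`, ties broken by `−t e_{k+1}`;
its two loop-neighbours are then `a + s e_k` and `a + t e_{k+1}`).
[cite: MadrasSlade1993, §3.2, eqs. (3.2.3)–(3.2.4) and Corollary 3.2.6 (proof: the re-rooted polygon lies in a half-space)] -/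
theorem exists_root (hω : ω ∈ sawFun 2 m eDown) (hm : 2 ≤ m) (k : Fin 2) {s t : ℤ} (hs : s = 1 ∨ s = -1)
    (ht : t = 1 ∨ t = -1) :
    ∃ i₀, i₀ ≤ m ∧
      ((rerootF m i₀ ω ∈ sawFun 2 m (Pi.single (k + 1) t) ∧ ∀ l ≤ m, 0 ≤ s * rerootF m i₀ ω l k) ∨
       (rerootB m i₀ ω ∈ sawFun 2 m (Pi.single (k + 1) t) ∧ ∀ l ≤ m, 0 ≤ s * rerootB m i₀ ω l k)) := by
  obtain ⟨h0, hend, hadj, hinj⟩ := mem_sawFun.1 hω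
  -- minimise `s y_k`, then `t y_{k+1}`
  obtain ⟨i₁, hi₁, hmin₁⟩ := Finset.exists_min_image (Finset.range (m + 1)) (fun i => s * ω i k) ⟨0, by simp⟩
  set S := (Finset.range (m + 1)).filter fun i => s * ω i k = s * ω i₁ k with hS
  obtain ⟨i₀, hi₀S, hmin₀⟩ := Finset.exists_min_image S (fun i => t * ω i (k + 1)) ⟨i₁, by simp [hS, hi₁]⟩
  rw [hS, Finset.mem_filter, Finset.mem_range] at hi₀S
  obtain ⟨hi₀m, hi₀k⟩ := hi₀S
  have hi₀ : i₀ ≤ m := by omega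
  set a := ω i₀ with ha
  have hmink : ∀ i ≤ m, s * a k ≤ s * ω i k := fun i hi => by
    rw [ha, hi₀k]; exact hmin₁ i (Finset.mem_range.2 (by omega))
  have hmink' : ∀ i ≤ m, s * ω i k = s * a k → t * a (k + 1) ≤ t * ω i (k + 1) := fun i hi he =>
    hmin₀ i (by rw [hS, Finset.mem_filter, Finset.mem_range]; exact ⟨by omega, by rw [he, ha, hi₀k]⟩)
  have hss : s * s = 1 := by rcases hs with rfl | rfl <;> norm_num
  have htt : t * t = 1 := by rcases ht with rfl | rfl <;> norm_num
  -- a loop-neighbour `b` of `a` is `a + s e_k` or `a + t e_{k+1}`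
  have key : ∀ i ≤ m, (zdGraph 2).Adj a (ω i) → ω i = a + Pi.single k s ∨ ω i = a + Pi.single (k + 1) t := by
    intro i hi hadj'
    obtain ⟨l, hl⟩ := (zdGraph_adj_iff _ _).1 hadj'
    have h1 := hmink i hi
    by_cases hlk : l = k
    · subst hlk
      left
      rcases hl with hl | hl
      · have e : ω i l = a l + 1 := by rw [hl]; simp
        rcases hs with rfl | rfl
        · exact hl
        · exfalso; rw [e] at h1; linarith
      · have e : a l = ω i l + 1 := by rw [hl]; simp
        rcases hs with rfl | rfl
        · exfalso; rw [e] at h1; linarith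
        · rw [eq_sub_of_add_eq hl.symm, sub_eq_add_neg, ← Pi.single_neg]
    · have hlk' := fin_two_eq_add_one hlk
      subst hlk'
      right
      rcases hl with hl | hl
      · have e1 : ω i k = a k := by rw [hl]; simp
        have e : ω i (k + 1) = a (k + 1) + 1 := by rw [hl]; simp
        have h2 := hmink' i hi (by rw [e1])
        rcases ht with rfl | rfl
        · exact hl
        · exfalso; rw [e] at h2; linarith
      · have e1 : ω i k = a k := by
          have : a k = ω i k := by rw [hl]; simp
          exact this.symm
        have e : a (k + 1) = ω i (k + 1) + 1 := by rw [hl]; simp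
        have h2 := hmink' i hi (by rw [e1])
        rcases ht with rfl | rfl
        · exfalso; rw [e] at h2; linarith
        · rw [eq_sub_of_add_eq hl.symm, sub_eq_add_neg, ← Pi.single_neg]
  -- the two loop-neighbours of `a`: predecessor `ω (idxF m i₀ m)` and successor `ω (idxB m i₀ m)`
  have hidxF : idxF m i₀ m ≤ m := by unfold idxF; split_ifs <;> omega
  have hidxB : idxB m i₀ m ≤ m := by unfold idxB; split_ifs <;> omega
  have hpred_adj : (zdGraph 2).Adj a (ω (idxF m i₀ m)) := by
    have h' := adj_idxB hω hi₀ (l := 0) (by omega)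
    have e0 : idxB m i₀ 0 = i₀ := by unfold idxB; simp
    have e1 : idxB m i₀ (0 + 1) = idxF m i₀ m := by unfold idxB idxF; split_ifs <;> omega
    rwa [e0, e1] at h'
  have hsucc_adj : (zdGraph 2).Adj a (ω (idxB m i₀ m)) := by
    have h' := adj_idxF hω hi₀ (l := 0) (by omega)
    have e0 : idxF m i₀ 0 = i₀ := by unfold idxF; simp [hi₀]
    have e1 : idxF m i₀ (0 + 1) = idxB m i₀ m := by unfold idxB idxF; split_ifs <;> omega
    rwa [e0, e1] at h'
  have hne : ω (idxF m i₀ m) ≠ ω (idxB m i₀ m) := by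
    intro h
    have := hinj hidxF hidxB h
    unfold idxF idxB at this; split_ifs at this <;> omega
  have hpred := key _ hidxF hpred_adj
  have hsucc := key _ hidxB hsucc_adj
  have hcons : ∀ l ≤ m, ∀ i ≤ m, 0 ≤ s * (ω i - a) k := by
    intro l _ i hi
    have := hmink i hi
    simp only [Pi.sub_apply, mul_sub]; linarith
  refine ⟨i₀, hi₀, ?_⟩
  rcases hpred with hp | hp
  · -- predecessor is `a + s e_k`, so the successor is `a + t e_{k+1}`: read backward
    have hsw : ω (idxB m i₀ m) = a + Pi.single (k + 1) t := by
      rcases hsucc with h | h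
      · exact absurd (hp.trans h.symm) hne
      · exact h
    right
    refine ⟨?_, fun l hl => ?_⟩
    · have := rerootB_mem_sawFun hω hi₀
      rwa [hsw, ha, add_sub_cancel_left] at this
    · simp only [rerootB]
      exact hcons l hl _ (by unfold idxB; split_ifs <;> omega)
  · -- predecessor is `a + t e_{k+1}`: read forward
    left
    refine ⟨?_, fun l hl => ?_⟩
    · have := rerootF_mem_sawFun hω hi₀
      rwa [hp, ha, add_sub_cancel_left] at this
    · simp only [rerootF]
      exact hcons l hl _ (by unfold idxF; split_ifs <;> omega)

/-! ### Counting -/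

open Classical in
/-- **Half-plane pieces are at least as numerous as walks closing next to the origin, up to the factor `2(m+1)`**:
for `m ≥ 2` and signs `s, t`, `c_m(0,e↓) ≤ 2 (m+1) · #{η ∈ sawFun 2 m (t e_{k+1}) : ∀ i ≤ m, 0 ≤ s η(i)_k}`.
[cite: MadrasSlade1993, §3.2, eqs. (3.2.1), (3.2.3)–(3.2.4); Corollary 3.2.6 (proof)] -/
theorem countAt_eDown_le_card_halfPlane {m : ℕ} (hm : 2 ≤ m) (k : Fin 2) {s t : ℤ} (hs : s = 1 ∨ s = -1)
    (ht : t = 1 ∨ t = -1) :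
    countAt 2 m eDown ≤ 2 * (m + 1) *
      ((sawFun 2 m (Pi.single (k + 1) t)).filter fun η => ∀ i ≤ m, 0 ≤ s * η i k).card := by
  set P := (sawFun 2 m (Pi.single (k + 1) t)).filter fun η => ∀ i ≤ m, 0 ≤ s * η i k with hP
  set CF : ℕ → Finset (ℕ → Site 2) := fun i₀ => (sawFun 2 m eDown).filter fun ω => rerootF m i₀ ω ∈ P with hCF
  set CB : ℕ → Finset (ℕ → Site 2) := fun i₀ => (sawFun 2 m eDown).filter fun ω => rerootB m i₀ ω ∈ P with hCB
  have hcover : sawFun 2 m eDown ⊆ (Finset.range (m + 1)).biUnion fun i₀ => CF i₀ ∪ CB i₀ := by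
    intro ω hω
    obtain ⟨i₀, hi₀, h⟩ := exists_root hω hm k hs ht
    rw [Finset.mem_biUnion]
    refine ⟨i₀, Finset.mem_range.2 (by omega), ?_⟩
    rw [Finset.mem_union]
    rcases h with h | h
    · exact Or.inl (Finset.mem_filter.2 ⟨hω, Finset.mem_filter.2 h⟩)
    · exact Or.inr (Finset.mem_filter.2 ⟨hω, Finset.mem_filter.2 h⟩)
  have hF : ∀ i₀ ∈ Finset.range (m + 1), (CF i₀).card ≤ P.card := by
    intro i₀ hi₀
    have hi₀' : i₀ ≤ m := Nat.le_of_lt_succ (Finset.mem_range.1 hi₀)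
    refine Finset.card_le_card_of_injOn (rerootF m i₀) (fun ω hω => ?_) ?_
    · rw [Finset.mem_coe, hCF, Finset.mem_filter] at hω; exact hω.2
    · intro ω₁ h₁ ω₂ h₂ h
      rw [Finset.mem_coe, hCF, Finset.mem_filter] at h₁ h₂
      rw [← unrootF_rerootF h₁.1 hi₀', h, unrootF_rerootF h₂.1 hi₀']
  have hB : ∀ i₀ ∈ Finset.range (m + 1), (CB i₀).card ≤ P.card := by
    intro i₀ hi₀
    have hi₀' : i₀ ≤ m := Nat.le_of_lt_succ (Finset.mem_range.1 hi₀)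
    refine Finset.card_le_card_of_injOn (rerootB m i₀) (fun ω hω => ?_) ?_
    · rw [Finset.mem_coe, hCB, Finset.mem_filter] at hω; exact hω.2
    · intro ω₁ h₁ ω₂ h₂ h
      rw [Finset.mem_coe, hCB, Finset.mem_filter] at h₁ h₂
      rw [← unrootB_rerootB h₁.1 hi₀', h, unrootB_rerootB h₂.1 hi₀']
  rw [← card_sawFun]
  calc (sawFun 2 m eDown).card ≤ ((Finset.range (m + 1)).biUnion fun i₀ => CF i₀ ∪ CB i₀).card :=
        Finset.card_le_card hcover
    _ ≤ ∑ i₀ ∈ Finset.range (m + 1), (CF i₀ ∪ CB i₀).card := Finset.card_biUnion_le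
    _ ≤ ∑ i₀ ∈ Finset.range (m + 1), (P.card + P.card) := Finset.sum_le_sum fun i₀ hi₀ =>
        (Finset.card_union_le _ _).trans (Nat.add_le_add (hF i₀ hi₀) (hB i₀ hi₀))
    _ = 2 * (m + 1) * P.card := by rw [Finset.sum_const, Finset.card_range, smul_eq_mul]; ring

end HalfPlanePieces

end Literature.Probability.RandomPlanarGeometry.SAW.Zd
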